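/-
Copyright (c) 2026 the pub-hodgecm-mathlib formalisation cell (harness21).  Prover seat hodgecm-mathlib-K2E3-p14 (g4) (free E3 hand on the E1 campaign
«EIS-RANK-ONE», deal «EIS-R6d₃» of K2E1-plan (g3) 2026-09-04T05:14:22Z), h413 = `stmt-HodgeConjecture-24833`, rung R6d₃ part (a): on `U(J₃) = U(2,1)`,
`E(f) − E(f)_B` IS the sum of the non-zero Fourier coefficients of the big-cell function along the HEISENBERG quotient `N(F)\N(𝔸)` — two abelian Poisson steps
(the centre line `Z ≅ 𝔸_F`, then `N∕Z ≅ 𝔸_E`), hypothesis-first.  2026-09-04.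
-/
import Summits.HodgeConjecture.HodgeConjecture.Theorems.K2E1EisensteinMinusConstantTermPoissonU2   -- ★ p857537 (K2E1-p02 (g5)): the `N = 2` template and §1 `tsum_sub_inv_measure_mul_integral_eq_tsum_indicator` (Poisson repackaged, any number field)
import Literature.NumberTheory.Automorphic.UnitaryGroupHeisenbergFundamentalDomain                  -- ★ `heisChart : 𝔸_E × 𝔸_E⁻ ≃ₜ N(𝔸_F)`, `ratHeis`, `toAdelic_ratHeis`, `ratHeisElt`, `exists_eq_ratHeisElt`
import HarnessLib

/-!
# h413 ∕ Track B «K2-LIT», «EIS-RANK-ONE» R6d₃ (a) — `K2E1EisensteinMinusConstantTermPoissonU3`: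
# `E(f)(g) − E(f)_B(g) = μ_F(D_F)⁻¹ · Σ_{x₀ ∈ E} Σ_{η ∈ F, η ≠ 0} 𝓕_F[Φ_g(x₀,·)](η) + μ_E(D_E)⁻¹ · Σ_{ξ ∈ E, ξ ≠ 0} 𝓕_E[Φ^Z_g](ξ)` ON `U(J₃)`

Cell `pub/hodgecm-mathlib`, crux H413 = `stmt-HodgeConjecture-24833`, route `HCCMUnconditional`; campaign SPEC `K2/K2E1-plan/g3/SPEC-EIS-R6-MaassSelberg` §2 R6d;
DEAL «EIS-R6d₃» (d₃-a) of K2E1-plan (g3) (K2 bus 2026-09-04T05:03:43Z ∕ 05:14:22Z) to the free E3 hand K2E3-p14 (g4).  THEOREMS ONLY (no `def`, no `instance`,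
no `notation`, no named-fact hypothesis, no `sorry`); lane `--kind proof --supports stmt-HodgeConjecture-24833 --as helper` (count-neutral).

THE MECHANISM (Mœglin–Waldspurger II.1.7; Garrett (2018) §2.8–§2.9; the `N = 2` twin is ★ p857537).  On `G = U(J₃)` the Borel Eisenstein series of a
left-`B(F)`-invariant `f` is `E(f)(g) = f(g) + Σ_{n ∈ N(F)} f(w₀ n g)` (★ `eisensteinSeriesU_eq_apply_add_tsum_unipotent_three`) and
`E(f)_B(g) = f(g) + (ν𝓕)⁻¹ ∫_{N(𝔸)} f(w₀ v g) dν` (★ `borelConstantTerm_eisensteinSeriesU_three`).  The unipotent radical is the HEISENBERG group: in the chart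
★ `heisChart : 𝔸_E × 𝔸_E⁻ ≃ N(𝔸_F)` with `𝔸_E⁻ = traceZeroLine(𝔸_F)` the rational points are `N(F) = {ratHeis x₀ (tδ) : x₀ ∈ E, t ∈ F}` (★ `exists_eq_ratHeisElt`), so with
`Φ_g(X, t) := f(w₀ · heisChart(X, tδ) · g)`:  `Σ_{n ∈ N(F)} f(w₀ n g) = Σ_{x₀ ∈ E} Σ_{t ∈ F} Φ_g(x₀, t)` (§2), and POISSON TWICE — in `t ∈ F ⊂ 𝔸_F` for each `x₀`
(centre direction; frequencies `η ∈ F`), then in `x₀ ∈ E ⊂ 𝔸_E` on `Φ^Z_g(X) := μ_F(D_F)⁻¹ ∫_{𝔸_F} Φ_g(X, t) dt` (frequencies `ξ ∈ E`) — whose `ξ = 0` term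
`μ_E(D_E)⁻¹ ∫ Φ^Z_g` is the constant-term integral (normalisation binder `hnorm`, as in the `N = 2` file).  All Poisson hypotheses enter as binders (hypothesis-first;
the decay file R6d (b)∕(c) discharges them).

* §2 `ratHeis_mem_unipotentU`, `exists_eq_ratHeis_of_mem_unipotentU`, **`tsum_unipotentU_three_eq_tsum`** — `Σ'_{n ∈ N(F)} T(n_𝔸) = Σ'_{(x₀,t) ∈ E × F} T(heisChart((x₀)_𝔸, tδ))`
  for every `T` (re-indexing along the bijection `E × F ≅ N(F)`).
* §3 **`eisensteinSeriesU_sub_borelConstantTerm_eq_three`** (THE HEAD) and the bound **`norm_eisensteinSeriesU_sub_borelConstantTerm_le_three`**.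

HONEST LABEL.  Count-neutral helper; proves no printed statement; HC_CM is proved only modulo the 7 printed citations (2 remaining named inputs: hLiu418 =
`stmt-HodgeConjecture-24832`, h413 = `stmt-HodgeConjecture-24833`) until rung 0 closes.

## References
* [MoeglinWaldspurger1995] C. Mœglin, J.-L. Waldspurger, *Spectral decomposition and Eisenstein series* (1995), I.2.6, II.1.7.
* [Garrett2018] P. Garrett, *Modern Analysis of Automorphic Forms by Example*, vol. 1 (2018), §2.8–§2.9.
* [CasselsFrohlichANT1967] J. W. S. Cassels, A. Fröhlich (eds.), *Algebraic Number Theory* (1967), Ch. XV (Tate) Lemma 4.2.4.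
* [Rogawski1990] J. D. Rogawski, *Automorphic Representations of Unitary Groups in Three Variables* (1990), §1.10, §2.1–§2.2.
-/

set_option autoImplicit false
set_option linter.dupNamespace false  -- the mandated namespace repeats the summit's segment (`HodgeConjecture.HodgeConjecture`)

noncomputable section

open scoped Matrix
open MeasureTheory NumberField IsDedekindDomain MulAction
open Literature.NumberTheory.Automorphic Literature.NumberTheory.Automorphic.UnitaryGroup
open Summit.HodgeConjecture.HodgeConjecture.Cruxes.H413.K2E1BorelEisensteinU
open Summit.HodgeConjecture.HodgeConjecture.Cruxes.H413.K2E1EisensteinSeriesLeftRight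
open Summit.HodgeConjecture.HodgeConjecture.Cruxes.H413.K2E1EisensteinMinusConstantTermPoissonU2

namespace Summit.HodgeConjecture.HodgeConjecture.Cruxes.H413.K2E1EisensteinMinusConstantTermPoissonU3

section Heisenberg

variable {F E : Type} [Field F] [NumberField F] [Field E] [NumberField E] [Algebra F E] [Algebra.IsQuadraticExtension F E] {c : E ≃ₐ[F] E}
  {δ : E}

/-! ## §2 `U(J₃)`: the rational Heisenberg group `N(F)` is `{ratHeis x₀ (tδ) : x₀ ∈ E, t ∈ F}` -/

omit [NumberField F] [NumberField E] [Algebra.IsQuadraticExtension F E] in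
/-- `c (ι t · δ) = −(ι t · δ)` for `t ∈ F`. [folklore] -/
theorem conj_algebraMap_mul_delta (hcδ : c δ = -δ) (t : F) : c (algebraMap F E t * δ) = -(algebraMap F E t * δ) := by
  rw [map_mul, AlgEquiv.commutes, hcδ, mul_neg]

omit [NumberField F] [Algebra.IsQuadraticExtension F E] in
/-- **`ratHeis x₀ y₀ ∈ N(F) ≤ U(J₃)(F)`** (its matrix `u(x₀, z₀)` is upper unitriangular); the element of ★ `rational = unitaryGroupOfForm` is re-packaged as an
element of `↥(unitaryGroupOfForm c J₃)`. [cite: Rogawski1990, §1.10] -/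
theorem ratHeis_mem_unipotentU (hc : c * c = 1) (x₀ : E) {y₀ : E} (hy₀ : c y₀ = -y₀) :
    (⟨(ratHeis hc x₀ hy₀).1, (ratHeis hc x₀ hy₀).2⟩ : ↥(unitaryGroupOfForm (c : E →+* E) ((StdForm.antidiagonal 3).over E))) ∈
      unipotentU (c : E →+* E) ((StdForm.antidiagonal 3).over E) := by
  refine (mem_unipotentU_iff _).2 ⟨?_, ?_⟩
  · intro i j hij
    change ratHeisMatrix (c := c) x₀ y₀ i j = 0
    fin_cases i <;> fin_cases j <;> simp_all [ratHeisMatrix]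
  · intro i
    change ratHeisMatrix (c := c) x₀ y₀ i i = 1
    fin_cases i <;> simp [ratHeisMatrix]

/-- **Every `n ∈ N(F) ≤ U(J₃)(F)` is a `ratHeis x₀ (tδ)`** (`x₀ ∈ E`, `t ∈ F`): `n_𝔸 ∈ N(𝔸_F)` is rational, hence a `ratHeisElt x₀ y₀` (★ `exists_eq_ratHeisElt`),
`toAdelic` is injective, and `y₀ ∈ E⁻` is `tδ` (★ `exists_eq_algebraMap_mul_of_conj_eq_neg`). [cite: Rogawski1990, §1.10] -/
theorem exists_eq_ratHeis_of_mem_unipotentU (hc : c * c = 1) (hcδ : c δ = -δ) (hδ : δ ≠ 0)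
    (n : ↥(unipotentU (c : E →+* E) ((StdForm.antidiagonal 3).over E))) :
    ∃ (x₀ : E) (t : F), (n : ↥(unitaryGroupOfForm (c : E →+* E) ((StdForm.antidiagonal 3).over E))) =
      ⟨(ratHeis hc x₀ (conj_algebraMap_mul_delta hcδ t)).1, (ratHeis hc x₀ (conj_algebraMap_mul_delta hcδ t)).2⟩ := by
  haveI : Nontrivial (AdeleRing (𝓞 E) E) := inferInstanceAs (Nontrivial (InfiniteAdeleRing E × FiniteAdeleRing (𝓞 E) E))
  obtain ⟨htri, hdiag⟩ := (mem_unipotentU_iff _).1 n.2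
  -- `n_𝔸 ∈ N(𝔸_F)`
  have hmemN : ((quasiSplit F E c 3).toAdelic (n : ↥(unitaryGroupOfForm (c : E →+* E) ((StdForm.antidiagonal 3).over E))) : (quasiSplit F E c 3).Adelic) ∈
      adelicUnipotent F E c 3 := by
    rw [mem_adelicUnipotent_iff, mem_upperUnitriangular_iff]
    refine ⟨fun i j hij => ?_, fun i => ?_⟩
    · change algebraMap E (AdeleRing (𝓞 E) E) ((((n : ↥(unitaryGroupOfForm (c : E →+* E) ((StdForm.antidiagonal 3).over E))) : GL (Fin 3) E) : Matrix (Fin 3) (Fin 3) E) i j) = 0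
      rw [htri hij, map_zero]
    · change algebraMap E (AdeleRing (𝓞 E) E) ((((n : ↥(unitaryGroupOfForm (c : E →+* E) ((StdForm.antidiagonal 3).over E))) : GL (Fin 3) E) : Matrix (Fin 3) (Fin 3) E) i i) = 1
      rw [hdiag i, map_one]
  set u : ↥(adelicUnipotent F E c 3) := ⟨_, hmemN⟩ with hu
  have huR : u ∈ rationalUnipotent F E c 3 := (mem_rationalUnipotent_iff u).2 ⟨(n : ↥(unitaryGroupOfForm (c : E →+* E) ((StdForm.antidiagonal 3).over E))), rfl⟩
  obtain ⟨x₀, y₀, hy₀, hγ⟩ := exists_eq_ratHeisElt hc (⟨u, huR⟩ : ↥(rationalUnipotent F E c 3))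
  obtain ⟨t, rfl⟩ := exists_eq_algebraMap_mul_of_conj_eq_neg E c hcδ hδ hy₀
  refine ⟨x₀, t, ?_⟩
  -- `toAdelic n = toAdelic (ratHeis x₀ (tδ))`, and `toAdelic` is injective on matrix entries
  have hA : ((quasiSplit F E c 3).toAdelic (n : ↥(unitaryGroupOfForm (c : E →+* E) ((StdForm.antidiagonal 3).over E))) : (quasiSplit F E c 3).Adelic) =
      ((quasiSplit F E c 3).toAdelic (ratHeis hc x₀ (conj_algebraMap_mul_delta hcδ t)) : (quasiSplit F E c 3).Adelic) := by
    have h := congrArg (fun γ : ↥(rationalUnipotent F E c 3) => ((γ : ↥(adelicUnipotent F E c 3)) : (quasiSplit F E c 3).Adelic)) hγ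
    exact h.trans (toAdelic_ratHeis hc x₀ (conj_algebraMap_mul_delta hcδ t)).symm
  apply Subtype.ext
  refine Matrix.GeneralLinearGroup.ext fun i j => ?_
  have hij := congrFun (congrFun (congrArg (fun x : (quasiSplit F E c 3).Adelic =>
    ((adelicVal F E c 3 _ x : GL (Fin 3) (AdeleRing (𝓞 E) E)) : Matrix (Fin 3) (Fin 3) (AdeleRing (𝓞 E) E))) hA) i) j
  exact (algebraMap E (AdeleRing (𝓞 E) E)).injective hij

/-- **RE-INDEXING THE BIG CELL ALONG THE HEISENBERG CHART**: `Σ'_{n ∈ N(F)} T(n_𝔸) = Σ'_{(x₀,t) ∈ E × F} T(heisChart((x₀)_𝔸, tδ))` for every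
`T : U(J₃)(𝔸_F) → ℂ` — `(x₀, t) ↦ ratHeis x₀ (tδ)` is a bijection `E × F ≅ N(F)` (Mathlib `Equiv.ofBijective`, `Equiv.tsum_eq`; ★ `toAdelic_ratHeis`,
★ `coe_traceZeroLine_algebraMap`). [cite: Rogawski1990, §1.10] -/
theorem tsum_unipotentU_three_eq_tsum (hc : c * c = 1) (hcδ : c δ = -δ) (hδ : δ ≠ 0) (T : (quasiSplit F E c 3).Adelic → ℂ) :
    ∑' n : ↥(unipotentU (c : E →+* E) ((StdForm.antidiagonal 3).over E)),
        T ((quasiSplit F E c 3).toAdelic (n : ↥(unitaryGroupOfForm (c : E →+* E) ((StdForm.antidiagonal 3).over E)))) =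
      ∑' p : E × F, T ((heisChart hc (algebraMap E (AdeleRing (𝓞 E) E) p.1, traceZeroLine F E c hcδ hδ (algebraMap F (AdeleRing (𝓞 F) F) p.2)) :
        ↥(adelicUnipotent F E c 3)) : (quasiSplit F E c 3).Adelic) := by
  classical
  let φ : E × F → ↥(unipotentU (c : E →+* E) ((StdForm.antidiagonal 3).over E)) :=
    fun p => ⟨⟨(ratHeis hc p.1 (conj_algebraMap_mul_delta hcδ p.2)).1, (ratHeis hc p.1 (conj_algebraMap_mul_delta hcδ p.2)).2⟩, ratHeis_mem_unipotentU hc p.1 _⟩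
  have hφ : ∀ p : E × F, (((φ p : ↥(unitaryGroupOfForm (c : E →+* E) ((StdForm.antidiagonal 3).over E))) : GL (Fin 3) E) : Matrix (Fin 3) (Fin 3) E) =
      ratHeisMatrix (c := c) p.1 (algebraMap F E p.2 * δ) := fun p => rfl
  have hinj : Function.Injective φ := by
    intro p q h
    have hM := congrArg (fun n : ↥(unipotentU (c : E →+* E) ((StdForm.antidiagonal 3).over E)) =>
      (((n : ↥(unitaryGroupOfForm (c : E →+* E) ((StdForm.antidiagonal 3).over E))) : GL (Fin 3) E) : Matrix (Fin 3) (Fin 3) E)) h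
    simp only [hφ] at hM
    have h01 := congrFun (congrFun hM 0) 1
    have h02 := congrFun (congrFun hM 0) 2
    simp only [ratHeisMatrix, Matrix.of_apply, Matrix.cons_val', Matrix.cons_val_zero, Matrix.cons_val_one, Matrix.cons_val_two, Matrix.empty_val',
      Matrix.cons_val_fin_one, Matrix.head_cons, Matrix.tail_cons] at h01 h02
    have h1 : p.1 = q.1 := h01
    have h2 : p.2 = q.2 := by
      rw [ratZ, ratZ, h1] at h02
      have h' : algebraMap F E p.2 * δ = algebraMap F E q.2 * δ := by linear_combination h02
      exact (algebraMap F E).injective (mul_right_cancel₀ hδ h')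
    exact Prod.ext h1 h2
  have hsurj : Function.Surjective φ := by
    intro n
    obtain ⟨x₀, t, hn⟩ := exists_eq_ratHeis_of_mem_unipotentU hc hcδ hδ n
    exact ⟨(x₀, t), Subtype.ext hn.symm⟩
  rw [← (Equiv.ofBijective φ ⟨hinj, hsurj⟩).tsum_eq]
  refine tsum_congr fun p => congrArg T ?_
  show ((quasiSplit F E c 3).toAdelic (ratHeis hc p.1 (conj_algebraMap_mul_delta hcδ p.2)) : (quasiSplit F E c 3).Adelic) = _
  rw [toAdelic_ratHeis]
  congr 3
  exact Subtype.ext (coe_traceZeroLine_algebraMap E c hcδ hδ p.2).symm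

/-! ## §3 `E(f) − E(f)_B` on `U(J₃)`: two Poisson steps on the Heisenberg quotient -/

/-- **`E(f)(g) − E(f)_B(g)` ON `U(J₃)` = the non-zero Fourier coefficients along the centre line, summed over `x₀ ∈ E`, plus the non-zero Fourier coefficients
of the centre-average `Φ^Z` along `N∕Z ≅ 𝔸_E`** (hypothesis-first; see the module docstring). [cite: MoeglinWaldspurger1995, II.1.7] [cite: Garrett2018, §2.8]
[cite: CasselsFrohlichANT1967, Ch. XV Lemma 4.2.4] -/
theorem eisensteinSeriesU_sub_borelConstantTerm_eq_three (hc : c * c = 1) (hcδ : c δ = -δ) (hδ : δ ≠ 0)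
    [MeasurableSpace (quasiSplit F E c 3).Adelic] [BorelSpace (quasiSplit F E c 3).Adelic]
    (νN : Measure ↥(adelicUnipotent F E c 3)) [νN.IsMulLeftInvariant] [νN.IsInvInvariant]
    {f : (quasiSplit F E c 3).Adelic → ℂ} (hfm : Measurable f)
    (hfN : ∀ (n : ↥(adelicUnipotent F E c 3)) (y : (quasiSplit F E c 3).Adelic), f ((n : (quasiSplit F E c 3).Adelic) * y) = f y)
    (hfB : ∀ b ∈ borelU (c : E →+* E) ((StdForm.antidiagonal 3).over E), ∀ x : (quasiSplit F E c 3).Adelic, f ((quasiSplit F E c 3).toAdelic b * x) = f x)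
    {𝓕 : Set ↥(adelicUnipotent F E c 3)} (h𝓕 : IsFundamentalDomain ↥(rationalUnipotent F E c 3) 𝓕 νN) (h𝓕₀ : νN 𝓕 ≠ 0) (h𝓕top : νN 𝓕 ≠ ⊤)
    (g : (quasiSplit F E c 3).Adelic)
    (hfin : ∫⁻ u in 𝓕, (∑' q : (quasiSplit F E c 3).quotientSubgroup ⧸ (borelAdelic F E c 3).subgroupOf (quasiSplit F E c 3).quotientSubgroup,
        ‖f ((((q.out : (quasiSplit F E c 3).quotientSubgroup) : (quasiSplit F E c 3).Adelic))⁻¹ * (u : (quasiSplit F E c 3).Adelic) * g)‖ₑ) ∂νN < ⊤)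
    (hs : Summable fun q : Quotient (orbitRel ↥(borelU (c : E →+* E) ((StdForm.antidiagonal 3).over E)) ↥(unitaryGroupOfForm (c : E →+* E) ((StdForm.antidiagonal 3).over E))) =>
      f ((quasiSplit F E c 3).toAdelic (Quotient.out q : ↥(unitaryGroupOfForm (c : E →+* E) ((StdForm.antidiagonal 3).over E))) * g))
    [MeasurableSpace (AdeleRing (𝓞 F) F)] [BorelSpace (AdeleRing (𝓞 F) F)] (μF : Measure (AdeleRing (𝓞 F) F)) [μF.IsAddHaarMeasure]
    [MeasurableSpace (AdeleRing (𝓞 E) E)] [BorelSpace (AdeleRing (𝓞 E) E)] (μE : Measure (AdeleRing (𝓞 E) E)) [μE.IsAddHaarMeasure]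
    {Φ : AdeleRing (𝓞 E) E → AdeleRing (𝓞 F) F → ℂ}
    (hΦ : ∀ X t, Φ X t = f (((quasiSplit F E c 3).toAdelic (weylLongU (c : E →+* E) (rfl : ((StdForm.antidiagonal 3).over E) = ((StdForm.antidiagonal 3).over E)))) *
      ((heisChart hc (X, traceZeroLine F E c hcδ hδ t) : ↥(adelicUnipotent F E c 3)) : (quasiSplit F E c 3).Adelic) * g))
    (hsumN : Summable fun p : E × F => ‖Φ (algebraMap E (AdeleRing (𝓞 E) E) p.1) (algebraMap F (AdeleRing (𝓞 F) F) p.2)‖)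
    (hΦc : ∀ x₀ : E, Continuous (Φ (algebraMap E (AdeleRing (𝓞 E) E) x₀)))
    (hΦi : ∀ x₀ : E, Integrable (Φ (algebraMap E (AdeleRing (𝓞 E) E) x₀)) μF)
    (hloc : ∀ x₀ : E, ∀ C : Set (AdeleRing (𝓞 F) F), IsCompact C → ∃ u : F → ℝ, Summable u ∧
      ∀ x ∈ C, ∀ ξ : F, ‖Φ (algebraMap E (AdeleRing (𝓞 E) E) x₀) (x + algebraMap F (AdeleRing (𝓞 F) F) ξ)‖ ≤ u ξ)
    (hsumF : ∀ x₀ : E, Summable fun η : F => ‖adeleFourierCoeff μF (Φ (algebraMap E (AdeleRing (𝓞 E) E) x₀)) η‖)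
    {ΦZ : AdeleRing (𝓞 E) E → ℂ} (hΦZ : ∀ X, ΦZ X = ((μF (adeleFundamentalDomain F)).toReal⁻¹ : ℂ) * ∫ t, Φ X t ∂μF)
    (hΦZc : Continuous ΦZ) (hΦZi : Integrable ΦZ μE)
    (hlocZ : ∀ C : Set (AdeleRing (𝓞 E) E), IsCompact C → ∃ u : E → ℝ, Summable u ∧
      ∀ x ∈ C, ∀ ξ : E, ‖ΦZ (x + algebraMap E (AdeleRing (𝓞 E) E) ξ)‖ ≤ u ξ)
    (hsumE : Summable fun ξ : E => ‖adeleFourierCoeff μE ΦZ ξ‖)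
    (hnorm : ((νN 𝓕).toReal⁻¹ : ℝ) • ∫ v : ↥(adelicUnipotent F E c 3), f (((quasiSplit F E c 3).toAdelic (weylLongU (c : E →+* E) (rfl : ((StdForm.antidiagonal 3).over E) = ((StdForm.antidiagonal 3).over E)))) * (v : (quasiSplit F E c 3).Adelic) * g) ∂νN =
      ((μE (adeleFundamentalDomain E)).toReal⁻¹ : ℂ) * ∫ X, ΦZ X ∂μE) :
    eisensteinSeriesU f g - borelConstantTerm νN 𝓕 (eisensteinSeriesU f) g =
      ((μF (adeleFundamentalDomain F)).toReal⁻¹ : ℂ) * ∑' x₀ : E, ∑' η : F, ({0}ᶜ : Set F).indicator (adeleFourierCoeff μF (Φ (algebraMap E (AdeleRing (𝓞 E) E) x₀))) η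
      + ((μE (adeleFundamentalDomain E)).toReal⁻¹ : ℂ) * ∑' ξ : E, ({0}ᶜ : Set E).indicator (adeleFourierCoeff μE ΦZ) ξ := by
  classical
  have hCT := borelConstantTerm_eisensteinSeriesU_three νN hfm hfN hfB h𝓕 h𝓕₀ h𝓕top g hfin
  have hE := eisensteinSeriesU_eq_apply_add_tsum_unipotent_three (F := F) (E := E) (c := c) (rfl : ((StdForm.antidiagonal 3).over E) = ((StdForm.antidiagonal 3).over E)) hfB hs
  -- (1) re-index the big cell along the Heisenberg chart
  have hre : ∑' n : ↥(unipotentU (c : E →+* E) ((StdForm.antidiagonal 3).over E)),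
      f ((quasiSplit F E c 3).toAdelic (weylLongU (c : E →+* E) (rfl : ((StdForm.antidiagonal 3).over E) = ((StdForm.antidiagonal 3).over E)) * (n : ↥(unitaryGroupOfForm (c : E →+* E) ((StdForm.antidiagonal 3).over E)))) * g) =
        ∑' p : E × F, Φ (algebraMap E (AdeleRing (𝓞 E) E) p.1) (algebraMap F (AdeleRing (𝓞 F) F) p.2) := by
    have hmul : ∀ n : ↥(unipotentU (c : E →+* E) ((StdForm.antidiagonal 3).over E)),
        (quasiSplit F E c 3).toAdelic (weylLongU (c : E →+* E) (rfl : ((StdForm.antidiagonal 3).over E) = ((StdForm.antidiagonal 3).over E)) * (n : ↥(unitaryGroupOfForm (c : E →+* E) ((StdForm.antidiagonal 3).over E)))) =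
          ((quasiSplit F E c 3).toAdelic (weylLongU (c : E →+* E) (rfl : ((StdForm.antidiagonal 3).over E) = ((StdForm.antidiagonal 3).over E)))) * (quasiSplit F E c 3).toAdelic (n : ↥(unitaryGroupOfForm (c : E →+* E) ((StdForm.antidiagonal 3).over E))) := fun n => map_mul _ _ _
    have h := tsum_unipotentU_three_eq_tsum hc hcδ hδ (fun x => f (((quasiSplit F E c 3).toAdelic (weylLongU (c : E →+* E) (rfl : ((StdForm.antidiagonal 3).over E) = ((StdForm.antidiagonal 3).over E)))) * x * g))
    simp only [hmul]
    simpa only [hΦ] using h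
  -- (2) the iterated sum
  have hsN : Summable fun p : E × F => Φ (algebraMap E (AdeleRing (𝓞 E) E) p.1) (algebraMap F (AdeleRing (𝓞 F) F) p.2) := Summable.of_norm hsumN
  have hprod : ∑' p : E × F, Φ (algebraMap E (AdeleRing (𝓞 E) E) p.1) (algebraMap F (AdeleRing (𝓞 F) F) p.2) =
      ∑' x₀ : E, ∑' t : F, Φ (algebraMap E (AdeleRing (𝓞 E) E) x₀) (algebraMap F (AdeleRing (𝓞 F) F) t) := hsN.tsum_prod
  -- (3) inner Poisson, per `x₀`
  have hinner : ∀ x₀ : E, ∑' t : F, Φ (algebraMap E (AdeleRing (𝓞 E) E) x₀) (algebraMap F (AdeleRing (𝓞 F) F) t) =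
      ΦZ (algebraMap E (AdeleRing (𝓞 E) E) x₀) +
        ((μF (adeleFundamentalDomain F)).toReal⁻¹ : ℂ) * ∑' η : F, ({0}ᶜ : Set F).indicator (adeleFourierCoeff μF (Φ (algebraMap E (AdeleRing (𝓞 E) E) x₀))) η := by
    intro x₀
    have h := tsum_sub_inv_measure_mul_integral_eq_tsum_indicator F μF (hΦc x₀) (hΦi x₀) (hloc x₀) (hsumF x₀)
    rw [hΦZ]
    linear_combination h
  -- (4) summability of the two families over `x₀`
  have hsZ : Summable fun x₀ : E => ΦZ (algebraMap E (AdeleRing (𝓞 E) E) x₀) := by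
    obtain ⟨u, hu, hule⟩ := hlocZ {0} isCompact_singleton
    refine Summable.of_norm_bounded hu fun ξ => ?_
    have h := hule 0 (Set.mem_singleton 0) ξ
    rwa [zero_add] at h
  have hsA : Summable fun x₀ : E => ((μF (adeleFundamentalDomain F)).toReal⁻¹ : ℂ) *
      ∑' η : F, ({0}ᶜ : Set F).indicator (adeleFourierCoeff μF (Φ (algebraMap E (AdeleRing (𝓞 E) E) x₀))) η := by
    have h1 : Summable fun x₀ : E => ∑' t : F, Φ (algebraMap E (AdeleRing (𝓞 E) E) x₀) (algebraMap F (AdeleRing (𝓞 F) F) t) := hsN.prod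
    have h2 := h1.sub hsZ
    refine h2.congr fun x₀ => ?_
    rw [hinner x₀]
    ring
  have hsplit : ∑' x₀ : E, ∑' t : F, Φ (algebraMap E (AdeleRing (𝓞 E) E) x₀) (algebraMap F (AdeleRing (𝓞 F) F) t) =
      ∑' x₀ : E, ΦZ (algebraMap E (AdeleRing (𝓞 E) E) x₀) +
        ((μF (adeleFundamentalDomain F)).toReal⁻¹ : ℂ) * ∑' x₀ : E, ∑' η : F, ({0}ᶜ : Set F).indicator (adeleFourierCoeff μF (Φ (algebraMap E (AdeleRing (𝓞 E) E) x₀))) η := by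
    rw [tsum_congr hinner, hsZ.tsum_add hsA, tsum_mul_left]
  -- (5) outer Poisson on `ΦZ`
  have houter := tsum_sub_inv_measure_mul_integral_eq_tsum_indicator E μE hΦZc hΦZi hlocZ hsumE
  -- (6) assemble
  rw [hCT, hE, hnorm, hre, hprod, hsplit, add_sub_add_left_eq_sub]
  linear_combination houter


/-- **`‖E(f)(g) − E(f)_B(g)‖ ≤ μ_F(D_F)⁻¹ Σ_{x₀} Σ_η 𝟙_{η≠0}‖𝓕_F[Φ_g(x₀,·)](η)‖ + μ_E(D_E)⁻¹ Σ_ξ 𝟙_{ξ≠0}‖𝓕_E[Φ^Z_g](ξ)‖` ON `U(J₃)`** — the form R6d (b) scales along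
the torus and R6e consumes as boundedness; one extra binder `hsumA` (summability over `x₀` of the inner coefficient sums of norms).
[cite: MoeglinWaldspurger1995, II.1.7] [cite: Garrett2018, §2.9] -/
theorem norm_eisensteinSeriesU_sub_borelConstantTerm_le_three (hc : c * c = 1) (hcδ : c δ = -δ) (hδ : δ ≠ 0)
    [MeasurableSpace (quasiSplit F E c 3).Adelic] [BorelSpace (quasiSplit F E c 3).Adelic]
    (νN : Measure ↥(adelicUnipotent F E c 3)) [νN.IsMulLeftInvariant] [νN.IsInvInvariant]
    {f : (quasiSplit F E c 3).Adelic → ℂ} (hfm : Measurable f)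
    (hfN : ∀ (n : ↥(adelicUnipotent F E c 3)) (y : (quasiSplit F E c 3).Adelic), f ((n : (quasiSplit F E c 3).Adelic) * y) = f y)
    (hfB : ∀ b ∈ borelU (c : E →+* E) ((StdForm.antidiagonal 3).over E), ∀ x : (quasiSplit F E c 3).Adelic, f ((quasiSplit F E c 3).toAdelic b * x) = f x)
    {𝓕 : Set ↥(adelicUnipotent F E c 3)} (h𝓕 : IsFundamentalDomain ↥(rationalUnipotent F E c 3) 𝓕 νN) (h𝓕₀ : νN 𝓕 ≠ 0) (h𝓕top : νN 𝓕 ≠ ⊤)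
    (g : (quasiSplit F E c 3).Adelic)
    (hfin : ∫⁻ u in 𝓕, (∑' q : (quasiSplit F E c 3).quotientSubgroup ⧸ (borelAdelic F E c 3).subgroupOf (quasiSplit F E c 3).quotientSubgroup,
        ‖f ((((q.out : (quasiSplit F E c 3).quotientSubgroup) : (quasiSplit F E c 3).Adelic))⁻¹ * (u : (quasiSplit F E c 3).Adelic) * g)‖ₑ) ∂νN < ⊤)
    (hs : Summable fun q : Quotient (orbitRel ↥(borelU (c : E →+* E) ((StdForm.antidiagonal 3).over E)) ↥(unitaryGroupOfForm (c : E →+* E) ((StdForm.antidiagonal 3).over E))) =>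
      f ((quasiSplit F E c 3).toAdelic (Quotient.out q : ↥(unitaryGroupOfForm (c : E →+* E) ((StdForm.antidiagonal 3).over E))) * g))
    [MeasurableSpace (AdeleRing (𝓞 F) F)] [BorelSpace (AdeleRing (𝓞 F) F)] (μF : Measure (AdeleRing (𝓞 F) F)) [μF.IsAddHaarMeasure]
    [MeasurableSpace (AdeleRing (𝓞 E) E)] [BorelSpace (AdeleRing (𝓞 E) E)] (μE : Measure (AdeleRing (𝓞 E) E)) [μE.IsAddHaarMeasure]
    {Φ : AdeleRing (𝓞 E) E → AdeleRing (𝓞 F) F → ℂ}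
    (hΦ : ∀ X t, Φ X t = f (((quasiSplit F E c 3).toAdelic (weylLongU (c : E →+* E) (rfl : ((StdForm.antidiagonal 3).over E) = ((StdForm.antidiagonal 3).over E)))) *
      ((heisChart hc (X, traceZeroLine F E c hcδ hδ t) : ↥(adelicUnipotent F E c 3)) : (quasiSplit F E c 3).Adelic) * g))
    (hsumN : Summable fun p : E × F => ‖Φ (algebraMap E (AdeleRing (𝓞 E) E) p.1) (algebraMap F (AdeleRing (𝓞 F) F) p.2)‖)
    (hΦc : ∀ x₀ : E, Continuous (Φ (algebraMap E (AdeleRing (𝓞 E) E) x₀)))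
    (hΦi : ∀ x₀ : E, Integrable (Φ (algebraMap E (AdeleRing (𝓞 E) E) x₀)) μF)
    (hloc : ∀ x₀ : E, ∀ C : Set (AdeleRing (𝓞 F) F), IsCompact C → ∃ u : F → ℝ, Summable u ∧
      ∀ x ∈ C, ∀ ξ : F, ‖Φ (algebraMap E (AdeleRing (𝓞 E) E) x₀) (x + algebraMap F (AdeleRing (𝓞 F) F) ξ)‖ ≤ u ξ)
    (hsumF : ∀ x₀ : E, Summable fun η : F => ‖adeleFourierCoeff μF (Φ (algebraMap E (AdeleRing (𝓞 E) E) x₀)) η‖)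
    {ΦZ : AdeleRing (𝓞 E) E → ℂ} (hΦZ : ∀ X, ΦZ X = ((μF (adeleFundamentalDomain F)).toReal⁻¹ : ℂ) * ∫ t, Φ X t ∂μF)
    (hΦZc : Continuous ΦZ) (hΦZi : Integrable ΦZ μE)
    (hlocZ : ∀ C : Set (AdeleRing (𝓞 E) E), IsCompact C → ∃ u : E → ℝ, Summable u ∧
      ∀ x ∈ C, ∀ ξ : E, ‖ΦZ (x + algebraMap E (AdeleRing (𝓞 E) E) ξ)‖ ≤ u ξ)
    (hsumE : Summable fun ξ : E => ‖adeleFourierCoeff μE ΦZ ξ‖)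
    (hsumA : Summable fun x₀ : E => ∑' η : F, ({0}ᶜ : Set F).indicator (fun η => ‖adeleFourierCoeff μF (Φ (algebraMap E (AdeleRing (𝓞 E) E) x₀)) η‖) η)
    (hnorm : ((νN 𝓕).toReal⁻¹ : ℝ) • ∫ v : ↥(adelicUnipotent F E c 3), f (((quasiSplit F E c 3).toAdelic (weylLongU (c : E →+* E) (rfl : ((StdForm.antidiagonal 3).over E) = ((StdForm.antidiagonal 3).over E)))) * (v : (quasiSplit F E c 3).Adelic) * g) ∂νN =
      ((μE (adeleFundamentalDomain E)).toReal⁻¹ : ℂ) * ∫ X, ΦZ X ∂μE) :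
    ‖eisensteinSeriesU f g - borelConstantTerm νN 𝓕 (eisensteinSeriesU f) g‖ ≤
      (μF (adeleFundamentalDomain F)).toReal⁻¹ * ∑' x₀ : E, ∑' η : F, ({0}ᶜ : Set F).indicator (fun η => ‖adeleFourierCoeff μF (Φ (algebraMap E (AdeleRing (𝓞 E) E) x₀)) η‖) η
      + (μE (adeleFundamentalDomain E)).toReal⁻¹ * ∑' ξ : E, ({0}ᶜ : Set E).indicator (fun ξ => ‖adeleFourierCoeff μE ΦZ ξ‖) ξ := by
  classical
  rw [eisensteinSeriesU_sub_borelConstantTerm_eq_three hc hcδ hδ νN hfm hfN hfB h𝓕 h𝓕₀ h𝓕top g hfin hs μF μE hΦ hsumN hΦc hΦi hloc hsumF hΦZ hΦZc hΦZi hlocZ hsumE hnorm]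
  -- termwise bounds `‖Σ ind F̂‖ ≤ Σ ind ‖F̂‖`
  have hone : ∀ {K : Type} [Field K] {G : K → ℂ} (hG : Summable fun ξ => ‖G ξ‖),
      ‖∑' ξ : K, ({0}ᶜ : Set K).indicator G ξ‖ ≤ ∑' ξ : K, ({0}ᶜ : Set K).indicator (fun ξ => ‖G ξ‖) ξ := by
    intro K _ G hG
    have hs' : Summable fun ξ : K => ({0}ᶜ : Set K).indicator (fun ξ => ‖G ξ‖) ξ := hG.indicator _
    refine (norm_tsum_le_tsum_norm ?_).trans (le_of_eq (tsum_congr fun ξ => ?_))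
    · refine hs'.of_nonneg_of_le (fun _ => norm_nonneg _) fun ξ => ?_
      rw [norm_indicator_eq_indicator_norm]
    · rw [norm_indicator_eq_indicator_norm]
  have hF0 : 0 ≤ (μF (adeleFundamentalDomain F)).toReal⁻¹ := inv_nonneg.2 ENNReal.toReal_nonneg
  have hE0 : 0 ≤ (μE (adeleFundamentalDomain E)).toReal⁻¹ := inv_nonneg.2 ENNReal.toReal_nonneg
  -- the double sum
  have hdouble : ‖∑' x₀ : E, ∑' η : F, ({0}ᶜ : Set F).indicator (adeleFourierCoeff μF (Φ (algebraMap E (AdeleRing (𝓞 E) E) x₀))) η‖ ≤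
      ∑' x₀ : E, ∑' η : F, ({0}ᶜ : Set F).indicator (fun η => ‖adeleFourierCoeff μF (Φ (algebraMap E (AdeleRing (𝓞 E) E) x₀)) η‖) η := by
    have hle : ∀ x₀ : E, ‖∑' η : F, ({0}ᶜ : Set F).indicator (adeleFourierCoeff μF (Φ (algebraMap E (AdeleRing (𝓞 E) E) x₀))) η‖ ≤
        ∑' η : F, ({0}ᶜ : Set F).indicator (fun η => ‖adeleFourierCoeff μF (Φ (algebraMap E (AdeleRing (𝓞 E) E) x₀)) η‖) η := fun x₀ => hone (hsumF x₀)
    have hsn : Summable fun x₀ : E => ‖∑' η : F, ({0}ᶜ : Set F).indicator (adeleFourierCoeff μF (Φ (algebraMap E (AdeleRing (𝓞 E) E) x₀))) η‖ :=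
      hsumA.of_nonneg_of_le (fun _ => norm_nonneg _) hle
    exact (norm_tsum_le_tsum_norm hsn).trans (hsn.tsum_le_tsum hle hsumA)
  calc ‖((μF (adeleFundamentalDomain F)).toReal⁻¹ : ℂ) * ∑' x₀ : E, ∑' η : F, ({0}ᶜ : Set F).indicator (adeleFourierCoeff μF (Φ (algebraMap E (AdeleRing (𝓞 E) E) x₀))) η
        + ((μE (adeleFundamentalDomain E)).toReal⁻¹ : ℂ) * ∑' ξ : E, ({0}ᶜ : Set E).indicator (adeleFourierCoeff μE ΦZ) ξ‖
      ≤ ‖((μF (adeleFundamentalDomain F)).toReal⁻¹ : ℂ) * ∑' x₀ : E, ∑' η : F, ({0}ᶜ : Set F).indicator (adeleFourierCoeff μF (Φ (algebraMap E (AdeleRing (𝓞 E) E) x₀))) η‖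
        + ‖((μE (adeleFundamentalDomain E)).toReal⁻¹ : ℂ) * ∑' ξ : E, ({0}ᶜ : Set E).indicator (adeleFourierCoeff μE ΦZ) ξ‖ := norm_add_le _ _
    _ ≤ (μF (adeleFundamentalDomain F)).toReal⁻¹ * ∑' x₀ : E, ∑' η : F, ({0}ᶜ : Set F).indicator (fun η => ‖adeleFourierCoeff μF (Φ (algebraMap E (AdeleRing (𝓞 E) E) x₀)) η‖) η
        + (μE (adeleFundamentalDomain E)).toReal⁻¹ * ∑' ξ : E, ({0}ᶜ : Set E).indicator (fun ξ => ‖adeleFourierCoeff μE ΦZ ξ‖) ξ := by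
      rw [norm_mul, norm_mul, norm_inv, norm_inv, Complex.norm_real, Complex.norm_real, Real.norm_of_nonneg ENNReal.toReal_nonneg,
        Real.norm_of_nonneg ENNReal.toReal_nonneg]
      exact add_le_add (mul_le_mul_of_nonneg_left hdouble hF0) (mul_le_mul_of_nonneg_left (hone hsumE) hE0)

end Heisenberg

end Summit.HodgeConjecture.HodgeConjecture.Cruxes.H413.K2E1EisensteinMinusConstantTermPoissonU3

end
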